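import Summits.ResolutionOfSingularities.ResolutionOfSingularities.Theorems.LossEntryPolygon
import HarnessLib

/-!
# LossEntryPolygon2 — §9 of lens-3 g28 T8b «LossEntryPolygon» (carry-free landing form)

WRITER NOTE (decomp-res-writer-1 g15): lens-3 g28 superseded T8 `LossEntryPolygon` (88ab088f, landed as
`Theorems.LossEntryPolygon` ✓p829977 on critic letter 220o) by T8b (sha256 29107665…, 367 l), which is T8 byte-identically
(§6–§8) plus the appended §9 below.  Landed Theorems files are not rewritten, so T8b lands CARRY-FREE: this file is T8b lines
265–365 VERBATIM (§9: 5 theorems) on `import …Theorems.LossEntryPolygon` (= T8b §6–§8), same namespace / section / variables;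
T8b's module docstring follows verbatim for provenance.  0-weight TOOL; decides nothing.

## (T8b header) LossEntryPolygon — the loss→entry law at the polygon level: after the two shears of a (b)-loss move and the cleaning,
the lexicographic minimum `(ε, ŷ)` of the ENTRY points `(N/D, a/D)` satisfies `ε ≤ α + β − 1` (E2) and `ŷ ≤ 1 − α + ε` (E3′),
hence `ŷ ≤ β` (E3) and `ε + ŷ − 1 < β` whenever `ε < 1`

decomp-res-lens-3, gen 28 (NODE-g28 §6.8 F21/R2 and §6.10; sequel of `Theorems.LossTaylor`).  TOOLS at 0: walk-free algebra over
`polyPts` / `vertexOf` of `Theorems.LossPolygon*` and the shear calculus of `Theorems.LossShear` / `Theorems.LossTaylor`.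
The walk-level law `lawLossEntry` (LossDescent) follows from these by the transport identities FACT 0 (`α_u = ε`, `β_u = ε + ŷ − 1`
for the run state after the untranslated repeat), the axis law (A) (`ε ≤ 1 − (d+1)/s`) and the `q`-th-power bound (B) (discharging
the survival hypothesis `hsurv`) — the successor generation's plumbing.  Desk evidence: E2/E3/E3′ exact in 11 823 legal loss samples
(HOME/decomp-res-lens-3/g28/f14/RESULTS.md).

* §6 `entryPt`, `entryPts` — the entry point `(N/D, a/D) = ((deg E − o)/(s − E l), E i/(s − E l))` and the entry point set.
* §7 `alphaOf_entryPts_le` — E2: the vertex monomial of `F` survives both shears and the cleaning, so `ε ≤ α + β − 1`.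
* §8 `betaOf_entryPts_le` — E3′: `ŷ ≤ 1 − α + ε` (the line of the minimum carries, by `exists_coeff_two_shears_ne_zero_le`, a surviving
  monomial with `i`-exponent `≤ B − k`, and the source bound `cast_sub_wall_le` gives `B − k ≤ (1 − α) D_P + N_P`);
  `betaOf_entryPts_le_betaOf` — E3: `ŷ ≤ β`; `entry_lt_betaOf` — the law `ε + ŷ − 1 < β` under `ε < 1`.
* §9 `div_le_fst_entryPt_of_isPthPowerExponent` (B), `alphaOf_entryPts_le_of_axisWitness` (A), and the packaged law
  `entry_lt_betaOf_of_axisWitness`: the survival hypothesis, `ε < 1` and non-emptiness are DISCHARGED by the tail arithmetic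
  (`s < q < o`, `2q + 1 ≤ o + s`, `ord F ≥ o`) and one AXIS WITNESS `R ∈ supp G`, `deg R + R l < 2q` (the pull-back of the axis law at `t+1`).
-/

open MvPolynomial Finset
open Literature.AlgebraicGeometry.Resolution
open Literature.AlgebraicGeometry.Resolution.Hauser2010
open Literature.AlgebraicGeometry.Resolution.PointBlowup
open Summit.ResolutionOfSingularities.ResolutionOfSingularities.Theorems.LossExitCone

namespace Summit.ResolutionOfSingularities.ResolutionOfSingularities.Theorems.LossPolygon

variable {K : Type} [Field K]

section Entry

variable {i j l : Fin 3}

/-! ## §9 Discharging the survival hypothesis: (A) the axis witness bounds `ε`, (B) `q`-th powers lie to the right of it -/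

/-- `degree_shearExp`: a shear preserves the degree of exponents. [folklore] -/
theorem degree_shearExp {a b c : Fin 3} (hab : a ≠ b) (hac : a ≠ c) (hbc : b ≠ c) (D : Fin 3 →₀ ℕ) {n : ℕ} (hn : n ≤ D c) :
    (shearExp a b c D n).degree = D.degree := by
  rw [degree_fin3 hab hac hbc, degree_fin3 hab hac hbc D, shearExp_apply_fst hab hac, shearExp_apply_snd hab hbc,
    shearExp_apply_thd hac hbc]
  omega

/-- `le_degree_of_mem_support_shear`: a lower bound on the degrees of the monomials passes through a shear. [folklore] -/
theorem le_degree_of_mem_support_shear {a b c : Fin 3} (hab : a ≠ b) (hac : a ≠ c) (hbc : b ≠ c) (g : K) {o : ℕ}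
    {F : MvPolynomial (Fin 3) K} (ho : ∀ D ∈ F.support, o ≤ D.degree) {E : Fin 3 →₀ ℕ} (hE : E ∈ (shear c a g F).support) :
    o ≤ E.degree := by
  obtain ⟨D, hD, n, hn, rfl⟩ := exists_shearExp_eq_of_mem_support_shear hab hac hbc g F hE
  rw [degree_shearExp hab hac hbc D hn]; exact ho D hD

/-- **(B) (PROVED): a `q`-th power monomial below the ceiling has entry abscissa `≥ (2q − o)/s`.**  (`s < q` forces its `l`-exponent to be
`0`, `q ∣ deg > q` forces `deg ≥ 2q`.) On the tail `2q − o = s − d`. [NODE-g28 §6.8 F21 (B); new; elementary] -/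
theorem div_le_fst_entryPt_of_isPthPowerExponent (hij : i ≠ j) (hil : i ≠ l) (hjl : j ≠ l) {q s o : ℕ} (hsq : s < q) (hqo : q < o)
    {E : Fin 3 →₀ ℕ} (hP : IsPthPowerExponent q E) (hoE : o ≤ E.degree) (hEl : E l < s) :
    ((((2 * q : ℕ) : ℚ)) - o) / s ≤ (entryPt s o i l E).1 := by
  have hdiv := (isPthPowerExponent_iff q E).mp hP
  have hl0 : E l = 0 := Nat.eq_zero_of_dvd_of_lt (hdiv l) (lt_trans hEl hsq)
  have hdeg : q ∣ E.degree := by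
    rw [degree_fin3 hij hil hjl E]; exact dvd_add (dvd_add (hdiv i) (hdiv j)) (hdiv l)
  have h2q : 2 * q ≤ E.degree := by
    obtain ⟨t, ht⟩ := hdeg
    have ht2 : 2 ≤ t := by
      by_contra h
      interval_cases t <;> simp [ht] at hqo hoE <;> omega
    rw [ht]; exact Nat.mul_comm 2 q ▸ Nat.mul_le_mul_left q ht2
  rw [fst_entryPt, hl0, Nat.cast_zero, sub_zero]
  have hs : (0 : ℚ) < s := by exact_mod_cast (lt_of_le_of_lt (Nat.zero_le _) hEl)
  have h2q' : ((2 * q : ℕ) : ℚ) ≤ E.degree := by exact_mod_cast h2q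
  exact div_le_div_of_nonneg_right (by linarith) hs.le

/-- **(A) (PROVED): an AXIS WITNESS bounds the minimal entry abscissa: `ε ≤ (2q − o − 1)/s`.**  An axis witness is a surviving monomial `R`
with `deg R + R l < 2q` — on the walk it is the pull-back through the chart of the loss wall of the monomial given by the axis law at `t+1`
for the pair `(j, l)`. [NODE-g28 §6.8 F21 (A) = E6 (tight in 36 % of the desk rows); new; elementary] -/
theorem alphaOf_entryPts_le_of_axisWitness {q s o : ℕ} (hos : 2 * q ≤ o + s) {G : MvPolynomial (Fin 3) K} {R : Fin 3 →₀ ℕ}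
    (hR : R ∈ G.support) (hoR : o ≤ R.degree) (hax : R.degree + R l < 2 * q) :
    alphaOf (entryPts s o i l G) ≤ ((((2 * q : ℕ) : ℚ)) - o - 1) / s := by
  have hRl : R l < s := by omega
  have hspos : 0 < s := by omega
  refine (alphaOf_le_fst (entryPt_mem_entryPts s o i l G hR hRl)).trans ?_
  rw [fst_entryPt]
  have hs : (0 : ℚ) < ((s : ℕ) : ℚ) - R l := by
    have : ((R l : ℕ) : ℚ) < s := by exact_mod_cast hRl
    linarith
  have hs' : (0 : ℚ) < s := by
    have : (0 : ℚ) ≤ ((R l : ℕ) : ℚ) := by exact_mod_cast Nat.zero_le _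
    linarith
  rw [div_le_div_iff₀ hs hs']
  have h1 : ((R.degree : ℕ) : ℚ) + R l + 1 ≤ ((2 * q : ℕ) : ℚ) := by exact_mod_cast hax
  have h2 : ((o : ℕ) : ℚ) ≤ R.degree := by exact_mod_cast hoR
  have h3 : ((2 * q : ℕ) : ℚ) ≤ (o : ℚ) + s := by exact_mod_cast hos
  have h4 : (0 : ℚ) ≤ ((R l : ℕ) : ℚ) := by exact_mod_cast Nat.zero_le _
  nlinarith

/-- **THE ENTRY LAW WITH THE SURVIVAL HYPOTHESIS DISCHARGED (PROVED).**  Frame `(j, i ; l)`, `r l = 0`, `o = r i + r j + s` the order, `F` clean of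
order `≥ o`, walls divide, `α < 1`, tail arithmetic `s < q < o` and `2q + 1 ≤ o + s` (`d ≥ 1`), run wall translated (`φ ≠ 0`), and an axis witness
`R` of `G = clean(σ_{i,j,φ} σ_{l,j,g} F)`: then `alphaOf(entryPts G) + betaOf(entryPts G) − 1 < betaOf(polyPts F)` — by FACT 0 this is `β_u < β_t`
for a (b)-loss followed by its repeat. [NODE-g28 §6.8 F21; for the walk: new] -/
theorem entry_lt_betaOf_of_axisWitness (hij : i ≠ j) (hil : i ≠ l) (hjl : j ≠ l) {q s : ℕ} {r : Fin 3 →₀ ℕ} (hrl : r l = 0)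
    {φ : K} (hφ : φ ≠ 0) (g : K) {F : MvPolynomial (Fin 3) K} (hclean : ∀ D ∈ F.support, ¬ IsPthPowerExponent q D)
    (hwall : ∀ D ∈ F.support, r ≤ D) (hdegF : ∀ D ∈ F.support, r i + r j + s ≤ D.degree) (hneF : (polyPts s r j i l F).Nonempty)
    (hα : alphaOf (polyPts s r j i l F) < 1) (hsq : s < q) (hqo : q < r i + r j + s) (hos : 2 * q + 1 ≤ r i + r j + s + s)
    {R : Fin 3 →₀ ℕ} (hR : R ∈ (deletePthPowers q (shear i j φ (shear l j g F))).support) (hax : R.degree + R l < 2 * q) :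
    alphaOf (entryPts s (r i + r j + s) i l (deletePthPowers q (shear i j φ (shear l j g F)))) +
        betaOf (entryPts s (r i + r j + s) i l (deletePthPowers q (shear i j φ (shear l j g F)))) - 1 <
      betaOf (polyPts s r j i l F) := by
  classical
  have hos' : 2 * q ≤ r i + r j + s + s := by omega
  have hdegσ : ∀ E ∈ (shear i j φ (shear l j g F)).support, r i + r j + s ≤ E.degree := fun E hE =>
    le_degree_of_mem_support_shear hjl hij.symm hil.symm φ
      (fun E' hE' => le_degree_of_mem_support_shear hij.symm hjl hil g hdegF hE') hE
  have hRσ : R ∈ (shear i j φ (shear l j g F)).support := by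
    have h := hR; rw [support_deletePthPowers'] at h; exact (Finset.mem_filter.mp h).1
  have hoR := hdegσ R hRσ
  have hRl : R l < s := by omega
  have hspos : 0 < s := by omega
  have hε := alphaOf_entryPts_le_of_axisWitness (i := i) hos' hR hoR hax
  have hs : (0 : ℚ) < s := by exact_mod_cast hspos
  have hε1 : alphaOf (entryPts s (r i + r j + s) i l (deletePthPowers q (shear i j φ (shear l j g F)))) < 1 := by
    refine lt_of_le_of_lt hε ?_
    rw [div_lt_one hs]
    have : ((2 * q : ℕ) : ℚ) ≤ ((r i + r j + s : ℕ) : ℚ) + s := by exact_mod_cast hos'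
    linarith
  have hsurv : ∀ E ∈ (shear i j φ (shear l j g F)).support, E l < s →
      (entryPt s (r i + r j + s) i l E).1 = alphaOf (entryPts s (r i + r j + s) i l (deletePthPowers q (shear i j φ (shear l j g F)))) →
      ¬ IsPthPowerExponent q E := by
    intro E hE hEl hfst hP
    have hB := div_le_fst_entryPt_of_isPthPowerExponent hij hil hjl hsq hqo hP (hdegσ E hE) hEl (i := i)
    rw [hfst] at hB
    have := hB.trans hε
    rw [div_le_div_iff_of_pos_right hs] at this
    linarith
  exact entry_lt_betaOf hij hil hjl hrl hφ g hclean hwall hneF hα hsurv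
    ⟨_, entryPt_mem_entryPts s (r i + r j + s) i l _ hR hRl⟩ hε1

end Entry

end Summit.ResolutionOfSingularities.ResolutionOfSingularities.Theorems.LossPolygon
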